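/-
Copyright (c) 2026 the pub-hodgecm-mathlib formalisation cell (harness21).  Prover seat hodgecm-mathlib-B-p14 (g32) — (R2) glue ∕ assembly heir, 2026-09-01.
«EP-LETTER-FOLD»: the letter (R2) `RankOneEulerPoincareNonsplit` from its per-place bodies at the unramified ∕ dyadic ∕ ramified non-split places.
-/
import Literature.NumberTheory.Rogawski1990.RankOneEulerPoincareNonsplitUnramifiedOdd   -- ★ (B-p14 g32) «EP-UNR-ODD»: the body at every unramified non-split `v ∤ 2`, hypothesis-free
import HarnessLib

/-!
# The rank-one Euler–Poincaré letter (R2) from its residues: unramified-dyadic and ramified non-split places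

Topic `NumberTheory/Rogawski1990`, namespace `Literature.NumberTheory.Rogawski1990`.  THEOREMS ONLY: no definition, no named fact, no instance, no notation,
no `sorry`; kernel lane.  The LETTER-LEVEL FOLD of the (R2) Euler–Poincaré road for `stub_N6nsR2EP : RankOneEulerPoincareNonsplit` (crux H413, line
«N6nsGerm», pen F0P2-p02 (g9); LEAD F0P3a-plan (g10) T9-8 (C)).  The letter ★ `RankOneEulerPoincareNonsplit` quantifies over every CM field `L` and every
finite place `v` of `L⁺` with ONE place of `L` above it; this file splits that range by the place `w ∣ v` (obtained from `Subsingleton (PlacesOver L v)`,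
`w̄ = w` since `c⁻¹ • w ∣ v` too — ★ `PlacesOver.galInv`; cf. ★ `smul_eq_of_subsingleton_placesOver`) into (a) `v` UNRAMIFIED in `L` with `2 ∈ 𝒪_w^×` — CLOSED in-house by ★ «EP-UNR-ODD»
`exists_isLocSmooth_classOrbitalIntegral_eq_one_zero_of_isUnit_two` (with `ϖ := ι_w(ϖ_v)`, ★ `valued_toPlace_uniformizer`, ★ `galAdicCompletionMap_toPlace_self`);
(b) `v` unramified DYADIC (`2 ∉ 𝒪_w^×`) — the type-blind tree relation ★ A-p17 `natCard_fixedBy_add_eq_natCard_fixedBy_add_one_congr` instantiated at `(Φ₂)_w`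
(B-p08 (g28) ∕ B-p04 (g35) ★ (hI) p843411 + finiteness p843428) through ★ `exists_isLocSmooth_classOrbitalIntegral_eq_one_zero_of_ellipticRelation`; (c) `v`
RAMIFIED in `L` — A-p06 (g27)'s (R2-ram) road.  HEADS: `rankOneEulerPoincareNonsplit_of_unramified_of_ramified` (two residues, the generic split) and
`rankOneEulerPoincareNonsplit_of_dyadic_of_ramified` (residues (b) + (c) only; (a) discharged).  Each residue is the letter's OWN per-place body,
so any road (relations package through ★ `exists_isLocSmooth_classOrbitalIntegral_eq_one_zero_of_relations_two`, or a direct construction) plugs in.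
HONEST LABEL: HC_CM is proved only modulo the cell's remaining named inputs (hLiu418, h413) until rung 0 closes; this file is unconditional (its
residues are hypotheses, not `sorry`s), and (R2) itself is a PRINTED theorem [Kottwitz1988, §2 Thm. 2] whose in-house proof these folds organise.

## References
* [Kottwitz1988] R. E. Kottwitz, *Tamagawa numbers*, Ann. of Math. 127 (1988), 629–646, §2 Theorem 2.
* [Rogawski1990] J. D. Rogawski, *Automorphic Representations of Unitary Groups in Three Variables* (1990), §12.6 p. 174.
* [CasselsFrohlichANT1967] J. W. S. Cassels, A. Fröhlich (eds.), *Algebraic Number Theory* (1967), Ch. II §10 (places above `v` in a quadratic extension).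
-/

set_option autoImplicit false

noncomputable section

open scoped ValuativeRel Matrix MatrixGroups
open Matrix ValuativeRel NumberField IsDedekindDomain MulAction MeasureTheory Measure

namespace Literature.NumberTheory.Rogawski1990

open Literature.NumberTheory.Automorphic Literature.NumberTheory.Automorphic.UnitaryGroup Literature.NumberTheory.GaloisRepresentations

/-! ## §1 At a place with one place above it, that place is `c`-fixed -/

/-- **`w̄ = w` for the place above a non-split `v`**: if `PlacesOver L v` is a subsingleton then `c • w = w` for each (the) `w ∣ v`
(`c⁻¹ • w` is again a place above `v`, ★ `PlacesOver.galInv`).  Local copy of ★ `smul_eq_of_subsingleton_placesOver` (N7 chain, p840482) to keep the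
import closure at the (R2) files. [cite: CasselsFrohlichANT1967, Ch. II §10] -/
private theorem smul_eq_of_subsingleton_placesOver' (L : Type) [Field L] [NumberField L] [IsCMField L]
    {v : HeightOneSpectrum (𝓞 ↥(maximalRealSubfield L))} (hsub : Subsingleton (UnitaryGroup.PlacesOver L v)) (w : UnitaryGroup.PlacesOver L v) :
    IsCMField.complexConj L • w.1 = w.1 := by
  have h := congrArg Subtype.val (Subsingleton.elim (UnitaryGroup.PlacesOver.galInv (IsCMField.complexConj L) w) w)
  change (IsCMField.complexConj L)⁻¹ • w.1 = w.1 at h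
  exact (inv_smul_eq_iff.1 h).symm

/-! ## §2 The letter from its per-place bodies -/

/-- **(R2) FROM ITS UNRAMIFIED AND RAMIFIED RESIDUES** (the generic split): if the body of `RankOneEulerPoincareNonsplit` holds at every non-split `v`
UNRAMIFIED in `L` and at every non-split `v` RAMIFIED in `L` (each stated with the place `w ∣ v`, `w̄ = w`, in hand), the letter holds.
[cite: Kottwitz1988, §2 Theorem 2] [cite: Rogawski1990, §12.6 p. 174] -/
theorem rankOneEulerPoincareNonsplit_of_unramified_of_ramified
    (hunr : ∀ (L : Type) [Field L] [NumberField L] [IsCMField L] (v : HeightOneSpectrum (𝓞 ↥(maximalRealSubfield L)))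
      (w : UnitaryGroup.PlacesOver L v) (hw : IsCMField.complexConj L • w.1 = w.1),
      Algebra.IsUnramifiedIn (𝓞 L) v.asIdeal →
      ∀ [MeasurableSpace ((UnitaryGroup.cmDatum L 2 (Matrix.of fun i j : Fin 2 => if i.val + j.val + 1 = 2 then (1 : L) else 0)).Local v)]
        [BorelSpace ((UnitaryGroup.cmDatum L 2 (Matrix.of fun i j : Fin 2 => if i.val + j.val + 1 = 2 then (1 : L) else 0)).Local v)]
        (ν : Measure ((UnitaryGroup.cmDatum L 2 (Matrix.of fun i j : Fin 2 => if i.val + j.val + 1 = 2 then (1 : L) else 0)).Local v))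
        [ν.IsHaarMeasure] [ν.IsMulRightInvariant]
        [_iZ : ∀ γ : (UnitaryGroup.cmDatum L 2 (Matrix.of fun i j : Fin 2 => if i.val + j.val + 1 = 2 then (1 : L) else 0)).Local v,
          MeasurableSpace (((UnitaryGroup.cmDatum L 2 (Matrix.of fun i j : Fin 2 => if i.val + j.val + 1 = 2 then (1 : L) else 0)).Local v) ⧸
            Subgroup.centralizer ({γ} : Set ((UnitaryGroup.cmDatum L 2 (Matrix.of fun i j : Fin 2 => if i.val + j.val + 1 = 2 then (1 : L) else 0)).Local v)))]
        [_bZ : ∀ γ : (UnitaryGroup.cmDatum L 2 (Matrix.of fun i j : Fin 2 => if i.val + j.val + 1 = 2 then (1 : L) else 0)).Local v,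
          BorelSpace (((UnitaryGroup.cmDatum L 2 (Matrix.of fun i j : Fin 2 => if i.val + j.val + 1 = 2 then (1 : L) else 0)).Local v) ⧸
            Subgroup.centralizer ({γ} : Set ((UnitaryGroup.cmDatum L 2 (Matrix.of fun i j : Fin 2 => if i.val + j.val + 1 = 2 then (1 : L) else 0)).Local v)))]
        (m : OrbitalMeasureFamily ((UnitaryGroup.cmDatum L 2 (Matrix.of fun i j : Fin 2 => if i.val + j.val + 1 = 2 then (1 : L) else 0)).Local v)),
        m.IsCanonical (fun γ => IsRegularElt (γ.val : GL (Fin 2) (UnitaryGroup.LocalRing L v))) ν →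
        ∃ f : (UnitaryGroup.cmDatum L 2 (Matrix.of fun i j : Fin 2 => if i.val + j.val + 1 = 2 then (1 : L) else 0)).Local v → ℂ, IsLocSmooth f ∧
          (∀ γ : (UnitaryGroup.cmDatum L 2 (Matrix.of fun i j : Fin 2 => if i.val + j.val + 1 = 2 then (1 : L) else 0)).Local v,
              IsRegularElt (γ.val : GL (Fin 2) (UnitaryGroup.LocalRing L v)) →
              CompactSpace (Subgroup.centralizer ({γ} : Set ((UnitaryGroup.cmDatum L 2 (Matrix.of fun i j : Fin 2 => if i.val + j.val + 1 = 2 then (1 : L) else 0)).Local v))) →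
              classOrbitalIntegral m f (ConjClasses.mk γ) = 1) ∧
          (∀ γ : (UnitaryGroup.cmDatum L 2 (Matrix.of fun i j : Fin 2 => if i.val + j.val + 1 = 2 then (1 : L) else 0)).Local v,
              IsRegularElt (γ.val : GL (Fin 2) (UnitaryGroup.LocalRing L v)) →
              ¬ CompactSpace (Subgroup.centralizer ({γ} : Set ((UnitaryGroup.cmDatum L 2 (Matrix.of fun i j : Fin 2 => if i.val + j.val + 1 = 2 then (1 : L) else 0)).Local v))) →
              classOrbitalIntegral m f (ConjClasses.mk γ) = 0))
    (hram : ∀ (L : Type) [Field L] [NumberField L] [IsCMField L] (v : HeightOneSpectrum (𝓞 ↥(maximalRealSubfield L)))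
      (w : UnitaryGroup.PlacesOver L v) (hw : IsCMField.complexConj L • w.1 = w.1),
      ¬ Algebra.IsUnramifiedIn (𝓞 L) v.asIdeal →
      ∀ [MeasurableSpace ((UnitaryGroup.cmDatum L 2 (Matrix.of fun i j : Fin 2 => if i.val + j.val + 1 = 2 then (1 : L) else 0)).Local v)]
        [BorelSpace ((UnitaryGroup.cmDatum L 2 (Matrix.of fun i j : Fin 2 => if i.val + j.val + 1 = 2 then (1 : L) else 0)).Local v)]
        (ν : Measure ((UnitaryGroup.cmDatum L 2 (Matrix.of fun i j : Fin 2 => if i.val + j.val + 1 = 2 then (1 : L) else 0)).Local v))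
        [ν.IsHaarMeasure] [ν.IsMulRightInvariant]
        [_iZ : ∀ γ : (UnitaryGroup.cmDatum L 2 (Matrix.of fun i j : Fin 2 => if i.val + j.val + 1 = 2 then (1 : L) else 0)).Local v,
          MeasurableSpace (((UnitaryGroup.cmDatum L 2 (Matrix.of fun i j : Fin 2 => if i.val + j.val + 1 = 2 then (1 : L) else 0)).Local v) ⧸
            Subgroup.centralizer ({γ} : Set ((UnitaryGroup.cmDatum L 2 (Matrix.of fun i j : Fin 2 => if i.val + j.val + 1 = 2 then (1 : L) else 0)).Local v)))]
        [_bZ : ∀ γ : (UnitaryGroup.cmDatum L 2 (Matrix.of fun i j : Fin 2 => if i.val + j.val + 1 = 2 then (1 : L) else 0)).Local v,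
          BorelSpace (((UnitaryGroup.cmDatum L 2 (Matrix.of fun i j : Fin 2 => if i.val + j.val + 1 = 2 then (1 : L) else 0)).Local v) ⧸
            Subgroup.centralizer ({γ} : Set ((UnitaryGroup.cmDatum L 2 (Matrix.of fun i j : Fin 2 => if i.val + j.val + 1 = 2 then (1 : L) else 0)).Local v)))]
        (m : OrbitalMeasureFamily ((UnitaryGroup.cmDatum L 2 (Matrix.of fun i j : Fin 2 => if i.val + j.val + 1 = 2 then (1 : L) else 0)).Local v)),
        m.IsCanonical (fun γ => IsRegularElt (γ.val : GL (Fin 2) (UnitaryGroup.LocalRing L v))) ν →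
        ∃ f : (UnitaryGroup.cmDatum L 2 (Matrix.of fun i j : Fin 2 => if i.val + j.val + 1 = 2 then (1 : L) else 0)).Local v → ℂ, IsLocSmooth f ∧
          (∀ γ : (UnitaryGroup.cmDatum L 2 (Matrix.of fun i j : Fin 2 => if i.val + j.val + 1 = 2 then (1 : L) else 0)).Local v,
              IsRegularElt (γ.val : GL (Fin 2) (UnitaryGroup.LocalRing L v)) →
              CompactSpace (Subgroup.centralizer ({γ} : Set ((UnitaryGroup.cmDatum L 2 (Matrix.of fun i j : Fin 2 => if i.val + j.val + 1 = 2 then (1 : L) else 0)).Local v))) →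
              classOrbitalIntegral m f (ConjClasses.mk γ) = 1) ∧
          (∀ γ : (UnitaryGroup.cmDatum L 2 (Matrix.of fun i j : Fin 2 => if i.val + j.val + 1 = 2 then (1 : L) else 0)).Local v,
              IsRegularElt (γ.val : GL (Fin 2) (UnitaryGroup.LocalRing L v)) →
              ¬ CompactSpace (Subgroup.centralizer ({γ} : Set ((UnitaryGroup.cmDatum L 2 (Matrix.of fun i j : Fin 2 => if i.val + j.val + 1 = 2 then (1 : L) else 0)).Local v))) →
              classOrbitalIntegral m f (ConjClasses.mk γ) = 0)) :
    RankOneEulerPoincareNonsplit := by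
  intro L _ _ _ v hsub _ _ ν _ _ _ _ m hm
  obtain ⟨w⟩ : Nonempty (UnitaryGroup.PlacesOver L v) := inferInstance
  have hw := smul_eq_of_subsingleton_placesOver' L hsub w
  by_cases hv : Algebra.IsUnramifiedIn (𝓞 L) v.asIdeal
  · exact hunr L v w hw hv ν m hm
  · exact hram L v w hw hv ν m hm

/-- **(R2) FROM ITS DYADIC AND RAMIFIED RESIDUES**: the body of `RankOneEulerPoincareNonsplit` at every unramified non-split `v ∤ 2` is ★ «EP-UNR-ODD»
`exists_isLocSmooth_classOrbitalIntegral_eq_one_zero_of_isUnit_two` (at `ϖ := ι_w(ϖ_v)`); so the letter follows from its body at the unramified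
non-split `v` with `2 ∉ 𝒪_w^×` and at the ramified non-split `v`. [cite: Kottwitz1988, §2 Theorem 2] [cite: Rogawski1990, §12.6 p. 174] -/
theorem rankOneEulerPoincareNonsplit_of_dyadic_of_ramified
    (hdy : ∀ (L : Type) [Field L] [NumberField L] [IsCMField L] (v : HeightOneSpectrum (𝓞 ↥(maximalRealSubfield L)))
      (w : UnitaryGroup.PlacesOver L v) (hw : IsCMField.complexConj L • w.1 = w.1),
      Algebra.IsUnramifiedIn (𝓞 L) v.asIdeal → ¬ IsUnit (2 : 𝒪[w.1.adicCompletion L]) →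
      ∀ [MeasurableSpace ((UnitaryGroup.cmDatum L 2 (Matrix.of fun i j : Fin 2 => if i.val + j.val + 1 = 2 then (1 : L) else 0)).Local v)]
        [BorelSpace ((UnitaryGroup.cmDatum L 2 (Matrix.of fun i j : Fin 2 => if i.val + j.val + 1 = 2 then (1 : L) else 0)).Local v)]
        (ν : Measure ((UnitaryGroup.cmDatum L 2 (Matrix.of fun i j : Fin 2 => if i.val + j.val + 1 = 2 then (1 : L) else 0)).Local v))
        [ν.IsHaarMeasure] [ν.IsMulRightInvariant]
        [_iZ : ∀ γ : (UnitaryGroup.cmDatum L 2 (Matrix.of fun i j : Fin 2 => if i.val + j.val + 1 = 2 then (1 : L) else 0)).Local v,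
          MeasurableSpace (((UnitaryGroup.cmDatum L 2 (Matrix.of fun i j : Fin 2 => if i.val + j.val + 1 = 2 then (1 : L) else 0)).Local v) ⧸
            Subgroup.centralizer ({γ} : Set ((UnitaryGroup.cmDatum L 2 (Matrix.of fun i j : Fin 2 => if i.val + j.val + 1 = 2 then (1 : L) else 0)).Local v)))]
        [_bZ : ∀ γ : (UnitaryGroup.cmDatum L 2 (Matrix.of fun i j : Fin 2 => if i.val + j.val + 1 = 2 then (1 : L) else 0)).Local v,
          BorelSpace (((UnitaryGroup.cmDatum L 2 (Matrix.of fun i j : Fin 2 => if i.val + j.val + 1 = 2 then (1 : L) else 0)).Local v) ⧸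
            Subgroup.centralizer ({γ} : Set ((UnitaryGroup.cmDatum L 2 (Matrix.of fun i j : Fin 2 => if i.val + j.val + 1 = 2 then (1 : L) else 0)).Local v)))]
        (m : OrbitalMeasureFamily ((UnitaryGroup.cmDatum L 2 (Matrix.of fun i j : Fin 2 => if i.val + j.val + 1 = 2 then (1 : L) else 0)).Local v)),
        m.IsCanonical (fun γ => IsRegularElt (γ.val : GL (Fin 2) (UnitaryGroup.LocalRing L v))) ν →
        ∃ f : (UnitaryGroup.cmDatum L 2 (Matrix.of fun i j : Fin 2 => if i.val + j.val + 1 = 2 then (1 : L) else 0)).Local v → ℂ, IsLocSmooth f ∧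
          (∀ γ : (UnitaryGroup.cmDatum L 2 (Matrix.of fun i j : Fin 2 => if i.val + j.val + 1 = 2 then (1 : L) else 0)).Local v,
              IsRegularElt (γ.val : GL (Fin 2) (UnitaryGroup.LocalRing L v)) →
              CompactSpace (Subgroup.centralizer ({γ} : Set ((UnitaryGroup.cmDatum L 2 (Matrix.of fun i j : Fin 2 => if i.val + j.val + 1 = 2 then (1 : L) else 0)).Local v))) →
              classOrbitalIntegral m f (ConjClasses.mk γ) = 1) ∧
          (∀ γ : (UnitaryGroup.cmDatum L 2 (Matrix.of fun i j : Fin 2 => if i.val + j.val + 1 = 2 then (1 : L) else 0)).Local v,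
              IsRegularElt (γ.val : GL (Fin 2) (UnitaryGroup.LocalRing L v)) →
              ¬ CompactSpace (Subgroup.centralizer ({γ} : Set ((UnitaryGroup.cmDatum L 2 (Matrix.of fun i j : Fin 2 => if i.val + j.val + 1 = 2 then (1 : L) else 0)).Local v))) →
              classOrbitalIntegral m f (ConjClasses.mk γ) = 0))
    (hram : ∀ (L : Type) [Field L] [NumberField L] [IsCMField L] (v : HeightOneSpectrum (𝓞 ↥(maximalRealSubfield L)))
      (w : UnitaryGroup.PlacesOver L v) (hw : IsCMField.complexConj L • w.1 = w.1),
      ¬ Algebra.IsUnramifiedIn (𝓞 L) v.asIdeal →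
      ∀ [MeasurableSpace ((UnitaryGroup.cmDatum L 2 (Matrix.of fun i j : Fin 2 => if i.val + j.val + 1 = 2 then (1 : L) else 0)).Local v)]
        [BorelSpace ((UnitaryGroup.cmDatum L 2 (Matrix.of fun i j : Fin 2 => if i.val + j.val + 1 = 2 then (1 : L) else 0)).Local v)]
        (ν : Measure ((UnitaryGroup.cmDatum L 2 (Matrix.of fun i j : Fin 2 => if i.val + j.val + 1 = 2 then (1 : L) else 0)).Local v))
        [ν.IsHaarMeasure] [ν.IsMulRightInvariant]
        [_iZ : ∀ γ : (UnitaryGroup.cmDatum L 2 (Matrix.of fun i j : Fin 2 => if i.val + j.val + 1 = 2 then (1 : L) else 0)).Local v,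
          MeasurableSpace (((UnitaryGroup.cmDatum L 2 (Matrix.of fun i j : Fin 2 => if i.val + j.val + 1 = 2 then (1 : L) else 0)).Local v) ⧸
            Subgroup.centralizer ({γ} : Set ((UnitaryGroup.cmDatum L 2 (Matrix.of fun i j : Fin 2 => if i.val + j.val + 1 = 2 then (1 : L) else 0)).Local v)))]
        [_bZ : ∀ γ : (UnitaryGroup.cmDatum L 2 (Matrix.of fun i j : Fin 2 => if i.val + j.val + 1 = 2 then (1 : L) else 0)).Local v,
          BorelSpace (((UnitaryGroup.cmDatum L 2 (Matrix.of fun i j : Fin 2 => if i.val + j.val + 1 = 2 then (1 : L) else 0)).Local v) ⧸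
            Subgroup.centralizer ({γ} : Set ((UnitaryGroup.cmDatum L 2 (Matrix.of fun i j : Fin 2 => if i.val + j.val + 1 = 2 then (1 : L) else 0)).Local v)))]
        (m : OrbitalMeasureFamily ((UnitaryGroup.cmDatum L 2 (Matrix.of fun i j : Fin 2 => if i.val + j.val + 1 = 2 then (1 : L) else 0)).Local v)),
        m.IsCanonical (fun γ => IsRegularElt (γ.val : GL (Fin 2) (UnitaryGroup.LocalRing L v))) ν →
        ∃ f : (UnitaryGroup.cmDatum L 2 (Matrix.of fun i j : Fin 2 => if i.val + j.val + 1 = 2 then (1 : L) else 0)).Local v → ℂ, IsLocSmooth f ∧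
          (∀ γ : (UnitaryGroup.cmDatum L 2 (Matrix.of fun i j : Fin 2 => if i.val + j.val + 1 = 2 then (1 : L) else 0)).Local v,
              IsRegularElt (γ.val : GL (Fin 2) (UnitaryGroup.LocalRing L v)) →
              CompactSpace (Subgroup.centralizer ({γ} : Set ((UnitaryGroup.cmDatum L 2 (Matrix.of fun i j : Fin 2 => if i.val + j.val + 1 = 2 then (1 : L) else 0)).Local v))) →
              classOrbitalIntegral m f (ConjClasses.mk γ) = 1) ∧
          (∀ γ : (UnitaryGroup.cmDatum L 2 (Matrix.of fun i j : Fin 2 => if i.val + j.val + 1 = 2 then (1 : L) else 0)).Local v,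
              IsRegularElt (γ.val : GL (Fin 2) (UnitaryGroup.LocalRing L v)) →
              ¬ CompactSpace (Subgroup.centralizer ({γ} : Set ((UnitaryGroup.cmDatum L 2 (Matrix.of fun i j : Fin 2 => if i.val + j.val + 1 = 2 then (1 : L) else 0)).Local v))) →
              classOrbitalIntegral m f (ConjClasses.mk γ) = 0)) :
    RankOneEulerPoincareNonsplit := by
  refine rankOneEulerPoincareNonsplit_of_unramified_of_ramified (fun L _ _ _ v w hw hv => ?_) hram
  intro _ _ ν _ _ _ _ m hm
  by_cases h2 : IsUnit (2 : 𝒪[w.1.adicCompletion L])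
  · exact exists_isLocSmooth_classOrbitalIntegral_eq_one_zero_of_isUnit_two L w hw
      (Units.mk0 _ (toPlace_uniformizer_ne_zero L v w hv)) (valued_toPlace_uniformizer L v w hv)
      (galAdicCompletionMap_toPlace_self L v w hw _) ν hv h2 hm
  · exact hdy L v w hw hv h2 ν m hm

end Literature.NumberTheory.Rogawski1990

end
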